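/-
Copyright (c) 2026 the pub-hodgecm-mathlib formalisation cell (harness21).  Prover seat hodgecm-mathlib-F0P3-p01 (g31), «(D-RAM) FOUR-FRAME» road of crux H413, line LH4, MS ROAD A,
STAGE B ∕ B5₂ (iv)₂: «GLUED STABILISER INDEX IN THE FULL UNIT TORUS — GENERAL CORNER» (the type-0∕type-2 orbit size).  2026-09-04.
-/
import Summits.HodgeConjecture.HodgeConjecture.Theorems.F0P3cDyRamDiagonalGluedStabiliserIndexCorner   -- ★ p856076 (this seat): corner membership ∕ defect lemmas; brings ★ FILE 1+2, ★ B1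
import Summits.HodgeConjecture.HodgeConjecture.Theorems.F0P3cDyRamDiagonalGluedStabiliserIndexFull     -- ★ p856033 (LH4-p08 (g2)): `mem_map_unitTorus_iff`, `relIndex_ratioLevel_unitTorus_eq`; brings ★ (O1)
import HarnessLib

/-!
# Crux `H413`, MS ROAD A, STAGE B ∕ B5₂ (iv)₂: «GLUED STABILISER INDEX IN THE FULL UNIT TORUS AT A GENERAL CORNER» `[𝒯 : S̃] = (q−1)q^{ρ+s+e−1}·(q−1)q^{2ρ+e−1}`

Cell `hodgecm-mathlib` (D-0151), FLOOR 0, crux item H413 = `stmt-HodgeConjecture-24833`; lane `--supports stmt-HodgeConjecture-24833 --as helper` (count-neutral).  THEOREMS ONLY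
(no `def`, no instance, no notation, no `sorry`).  The general-corner twin of ★ p856033 `F0P3cDyRamDiagonalGluedStabiliserIndexFull` (LH4-p08 (g2), corner `2ρ + s`), on the
engine of ★ p856076 `F0P3cDyRamDiagonalGluedStabiliserIndexCorner` (this seat): for `V = (1 0 0; x ϖ^ρ 0; xζ+y″ ϖ^ρζ ϖ^{2ρ+s+e})`, `|x| = |ζ| = 1`, `|y″| = |ϖ|^s`, `ρ ≥ 1`, any `e`
(`e = 1`: the TYPE-2 glued stratum `G₁(2ρ+1, s)` of LH4-p10 (g2) MEMO v2.1 §T2.3), the stabiliser of `latt V` in the full unit torus `𝒯 = (𝒪^×)³` has index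
`[𝒯 : S̃(latt V)] = ((q−1)q^{ρ+s+e−1}) · ((q−1)q^{2ρ+e−1})` — two exact steps: `u₁∕u₂ ∈ U_{ρ+s+e}` (`[𝒪^× : U_n] = (q−1)q^{n−1}`, ★ B1 (C3)) and the twisted homomorphism
`u ↦ (u₀∕u₂)(1 + g(1 − u₁∕u₂))⁻¹` into `K^×∕U_{2ρ+e}` with the EXACT lineariser `g = xζ∕y″` (kernel `S̃`, image `𝒪^×U_{2ρ+e}∕U_{2ρ+e}`).  Hence the orbit size
`#(𝒯·latt V) = ((q−1)q^{ρ+s+e−1})·((q−1)q^{2ρ+e−1})` (★ (O1) `ncard_unitTorus_orbit_eq_relIndex`) — the type-2 lattice-count input of B5₂ (iv)₂.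
* `mem_latticeStabilizer_latt_glued_corner_lin_iff` — for `u ∈ 𝒯`: `u ∈ Stab(latt V) ⟺ |u₂−u₁| ≤ |ϖ|^{ρ+s+e} ∧ |g(u₂−u₁) + (u₂−u₀)| ≤ |ϖ|^{2ρ+e}` (any lineariser `g`).
* `relIndex_latticeStabilizer_ratioLevel_corner_eq` — step 2, `(q−1)q^{2ρ+e−1}`.
* **`relIndex_latticeStabilizer_latt_glued_corner_eq`**, **`ncard_unitTorus_orbit_latt_glued_corner_eq`**, and the type-2 letters (corner `2ρ+1+s`):
  `relIndex_latticeStabilizer_latt_glued_typeTwo_eq`, `ncard_unitTorus_orbit_latt_glued_typeTwo_eq` (`= ((q−1)q^{ρ+s})·((q−1)q^{2ρ})`).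
HONEST LABEL.  Count-neutral (`--supports`); the census laws (MS) stay PROVER TARGETS until the Stage B ∕ B9 assemblies land; `HC_CM` is proved only modulo the 7 printed citations
(2 remaining named inputs: hLiu418 = `stmt-HodgeConjecture-24832`, h413 = `stmt-HodgeConjecture-24833`) until rung 0 closes.

## References
* [Kottwitz1986BaseChangeUnits] R. E. Kottwitz, *Base change for unit elements of Hecke algebras*, Compositio Math. 60 (1986), §1 pp. 240–241 (torus orbits of lattices, stabilisers).
* [Serre1979] J.-P. Serre, *Local Fields*, GTM 67 (1979), Ch. IV §2 Prop. 6 (`[U : Uⁿ] = (q−1)q^{n−1}`).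
* [Serre1980Trees] J.-P. Serre, *Trees*, Springer (1980), Ch. II §1.1 (lattices, diagonal action, Hermite normal form).
-/

set_option autoImplicit false

noncomputable section

namespace Summit.HodgeConjecture.HodgeConjecture.Cruxes.H413.F0P3cDyRamDiagonalGluedStabiliserIndexFullCorner

open Matrix
open Literature.NumberTheory.Automorphic Literature.NumberTheory.Automorphic.HermitianLattice Literature.NumberTheory.Automorphic.UnitaryGroup
open Literature.NumberTheory.Automorphic.UnitaryLatticeTree
open Literature.NumberTheory.LocalFields.WildQuadraticDatum
open Summit.HodgeConjecture.HodgeConjecture.Cruxes.H413.F0P3cDyRamDiagonalTorusDefs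
open Summit.HodgeConjecture.HodgeConjecture.Cruxes.H413.F0P3cDyRamDiagonalGluedFixedStabiliser
open Summit.HodgeConjecture.HodgeConjecture.Cruxes.H413.F0P3cDyRamDiagonalGluedStabiliserIndex (ne_zero_and_v_lt_one_of_v_eq_exp v_div_sub_one_eq)
open Summit.HodgeConjecture.HodgeConjecture.Cruxes.H413.F0P3cDyRamDiagonalGluedStabiliserIndexCorner
open Summit.HodgeConjecture.HodgeConjecture.Cruxes.H413.F0P3cDyRamDiagonalGluedStabiliserIndexFull (mem_map_unitTorus_iff relIndex_ratioLevel_unitTorus_eq)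
open Summit.HodgeConjecture.HodgeConjecture.Cruxes.H413.F0P3cDyRamDiagonalUnitTorusOrbit (ncard_unitTorus_orbit_eq_relIndex)
open scoped Valued WithZero Matrix MatrixGroups

variable {K : Type*} [Field K] [Valued K ℤᵐ⁰]

/-! ## §1  Linearised membership in the full-torus stabiliser at a general corner -/

/-- **`S̃(latt V)` AT A GENERAL CORNER ⟺ (b) ∧ (c′)** for `u ∈ 𝒯` and any lineariser `g` (`|g|·|ϖ|^s ≤ 1`, `|xζ − g y″| ≤ |ϖ|^ρ`; `g := xζ∕y″` is exact):
`u ∈ Stab(latt V) ⟺ |u₂−u₁| ≤ |ϖ|^{ρ+s+e} ∧ |g(u₂−u₁) + (u₂−u₀)| ≤ |ϖ|^{2ρ+e}` (★ p856076 `mem_latticeStabilizer_latt_glued_corner_iff` + `glued_corner_iff_corner` +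
`glued_first_of_corner_corner`). [cite: Kottwitz1986BaseChangeUnits, §1 pp. 240–241] -/
theorem mem_latticeStabilizer_latt_glued_corner_lin_iff {ϖ : K} (hϖ0 : ϖ ≠ 0) (hϖ1 : Valued.v ϖ ≤ 1) (ρ s e : ℕ) {x ζ y'' g : K}
    (hx : Valued.v x = 1) (hζ : Valued.v ζ = 1) (hy'' : Valued.v y'' = Valued.v ϖ ^ s) (hg : Valued.v g * Valued.v ϖ ^ s ≤ 1)
    (hlin : Valued.v (x * ζ - g * y'') ≤ Valued.v ϖ ^ ρ)
    (V : GL (Fin 3) K) (hV : (V : Matrix (Fin 3) (Fin 3) K) = !![1, 0, 0; x, ϖ ^ ρ, 0; x * ζ + y'', ϖ ^ ρ * ζ, ϖ ^ (2 * ρ + s + e)])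
    {u : Fin 3 → Kˣ} (hu : u ∈ unitTorus K 3) :
    u ∈ latticeStabilizer (latt (V : Matrix (Fin 3) (Fin 3) K)) ↔
      Valued.v ((u 2 : K) - u 1) ≤ Valued.v ϖ ^ (ρ + s + e) ∧ Valued.v (g * ((u 2 : K) - u 1) + ((u 2 : K) - u 0)) ≤ Valued.v ϖ ^ (2 * ρ + e) := by
  have hu1 := (mem_unitTorus_iff u).1 hu
  rw [mem_latticeStabilizer_latt_glued_corner_iff hϖ0 ρ s e hx hζ V hV u hu1]
  constructor
  · rintro ⟨-, hb, hc⟩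
    exact ⟨hb, (glued_corner_iff_corner hϖ0 ρ s e hy'' hlin hb).1 hc⟩
  · rintro ⟨hb, hc'⟩
    have hc := (glued_corner_iff_corner hϖ0 ρ s e hy'' hlin hb).2 hc'
    refine ⟨?_, hb, hc⟩
    have ha := glued_first_of_corner_corner hϖ1 ρ s e hg hb hc'
    rwa [show ((u 2 : K) - u 0) - ((u 2 : K) - u 1) = (u 1 : K) - u 0 by ring] at ha

/-! ## §2  Step 2 of the index at a general corner, full torus -/

/-- **STEP 2, general corner, full torus: `[S₁ : S̃(latt V)] = (q−1)·q^{2ρ+e−1}`** (`S₁ = {u ∈ 𝒯 | u₁∕u₂ ∈ U_{ρ+s+e}}`): the twisted map `u ↦ (u₀∕u₂)·(1 + g(1 − u₁∕u₂))⁻¹`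
is a homomorphism `S₁ → K^×∕U_{2ρ+e}` (★ `v_defect_le_corner`), kernel `S̃`, image `𝒪^×·U_{2ρ+e}∕U_{2ρ+e}`, of cardinality `[𝒪^× : U_{2ρ+e}] = (q−1)q^{2ρ+e−1}` (★ B1 (C3)).
[cite: Kottwitz1986BaseChangeUnits, §1 pp. 240–241] [cite: Serre1979, Ch. IV §2 Prop. 6] -/
theorem relIndex_latticeStabilizer_ratioLevel_corner_eq {ϖ : K} (hϖ : Valued.v ϖ = WithZero.exp (-1 : ℤ)) [Finite 𝓀[K]] {ρ : ℕ} (hρ : 1 ≤ ρ) (s e : ℕ) {x ζ y'' g : K}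
    (hx : Valued.v x = 1) (hζ : Valued.v ζ = 1) (hy'' : Valued.v y'' = Valued.v ϖ ^ s) (hg : Valued.v g * Valued.v ϖ ^ s ≤ 1)
    (hlin : Valued.v (x * ζ - g * y'') ≤ Valued.v ϖ ^ ρ)
    (V : GL (Fin 3) K) (hV : (V : Matrix (Fin 3) (Fin 3) K) = !![1, 0, 0; x, ϖ ^ ρ, 0; x * ζ + y'', ϖ ^ ρ * ζ, ϖ ^ (2 * ρ + s + e)])
    (π : (Fin 3 → Kˣ) →* Kˣ) (hπ : ∀ u, π u = u 1 / u 2)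
    (Uρs : Subgroup Kˣ) (hU : ∀ w : Kˣ, w ∈ Uρs ↔ Valued.v (w : K) = 1 ∧ Valued.v ((w : K) - 1) ≤ Valued.v ϖ ^ (ρ + s + e)) :
    (latticeStabilizer (latt (V : Matrix (Fin 3) (Fin 3) K))).relIndex (Uρs.comap π ⊓ unitTorus K 3) =
      (Nat.card 𝓀[K] - 1) * Nat.card 𝓀[K] ^ (2 * ρ + e - 1) := by
  obtain ⟨hϖ0, hϖ1⟩ := ne_zero_and_v_lt_one_of_v_eq_exp hϖ
  set T := unitTorus K 3 with hT
  set S := latticeStabilizer (latt (V : Matrix (Fin 3) (Fin 3) K)) with hS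
  set S₁ := Uρs.comap π ⊓ T with hS₁
  -- the level-`2ρ+e` subgroup of `K^×`
  obtain ⟨U2, hU2⟩ := exists_unitLevel_subgroup (K := K) (Valued.v ϖ ^ (2 * ρ + e))
  have hρse : Valued.v ϖ ^ (ρ + s + e) ≤ Valued.v ϖ ^ (ρ + s) := pow_le_pow_right_of_le_one' hϖ1.le (by omega)
  -- membership in `S₁`, read in `K`
  have mem_S₁ : ∀ u : Fin 3 → Kˣ, u ∈ S₁ ↔
      (Valued.v ((u 1 : K) / (u 2 : K)) = 1 ∧ Valued.v ((u 1 : K) / (u 2 : K) - 1) ≤ Valued.v ϖ ^ (ρ + s + e)) ∧ ∀ i, Valued.v (u i : K) = 1 := by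
    intro u
    rw [hS₁, Subgroup.mem_inf, Subgroup.mem_comap, hU, hπ, Units.val_div_eq_div_val, hT, mem_unitTorus_iff]
  -- the twisted ratio and its properties
  have hcu : ∀ u ∈ S₁, Valued.v (g * (1 - (u 1 : K) / (u 2 : K))) ≤ Valued.v ϖ ^ ρ ∧ Valued.v (1 + g * (1 - (u 1 : K) / (u 2 : K))) = 1 :=
    fun u hu => v_one_add_mul_one_sub_eq_one hϖ1 hρ s hg (((mem_S₁ u).1 hu).1.2.trans hρse)
  have hval : ∀ u ∈ S₁, Valued.v (((u 0 : K) / (u 2 : K)) / (1 + g * (1 - (u 1 : K) / (u 2 : K)))) = 1 := fun u hu => by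
    obtain ⟨-, hu1⟩ := (mem_S₁ u).1 hu
    rw [map_div₀, map_div₀, hu1 0, hu1 2, (hcu u hu).2, div_one, div_one]
  have hne : ∀ u ∈ S₁, ((u 0 : K) / (u 2 : K)) / (1 + g * (1 - (u 1 : K) / (u 2 : K))) ≠ 0 := fun u hu h => by
    have h1 := hval u hu
    rw [h, map_zero] at h1
    exact zero_ne_one h1
  have hc0 : ∀ u ∈ S₁, (1 + g * (1 - (u 1 : K) / (u 2 : K))) ≠ 0 := fun u hu h => by
    have h1 := (hcu u hu).2
    rw [h, map_zero] at h1
    exact zero_ne_one h1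
  let θ : S₁ → Kˣ := fun u => Units.mk0 _ (hne u.1 u.2)
  have hθ : ∀ u : S₁, ((θ u : Kˣ) : K) = ((u.1 0 : K) / (u.1 2 : K)) / (1 + g * (1 - (u.1 1 : K) / (u.1 2 : K))) := fun u => rfl
  -- `θ` is a homomorphism modulo `U_{2ρ+e}`
  have hmul : ∀ u u' : S₁, (QuotientGroup.mk' U2) (θ (u * u')) = (QuotientGroup.mk' U2) (θ u) * (QuotientGroup.mk' U2) (θ u') := by
    intro u u'
    obtain ⟨⟨-, ha⟩, hu1⟩ := (mem_S₁ u.1).1 u.2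
    obtain ⟨⟨-, ha'⟩, hu1'⟩ := (mem_S₁ u'.1).1 u'.2
    have hcc := (hcu u.1 u.2).2
    have hcc' := (hcu u'.1 u'.2).2
    have hC := (hcu (u * u').1 (u * u').2).2
    have hC0 := hc0 (u * u').1 (u * u').2
    rw [← map_mul, QuotientGroup.mk'_apply, QuotientGroup.mk'_apply, QuotientGroup.eq_iff_div_mem, hU2, Units.val_div_eq_div_val, Units.val_mul,
      hθ, hθ, hθ]
    have ea : ((u * u').1 1 : K) / ((u * u').1 2 : K) = (u.1 1 : K) / (u.1 2 : K) * ((u'.1 1 : K) / (u'.1 2 : K)) := by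
      simp only [Subgroup.coe_mul, Pi.mul_apply, Units.val_mul]; rw [mul_div_mul_comm]
    have eb : ((u * u').1 0 : K) / ((u * u').1 2 : K) = (u.1 0 : K) / (u.1 2 : K) * ((u'.1 0 : K) / (u'.1 2 : K)) := by
      simp only [Subgroup.coe_mul, Pi.mul_apply, Units.val_mul]; rw [mul_div_mul_comm]
    rw [ea] at hC hC0
    rw [ea, eb]
    have hb0 : (u.1 0 : K) / (u.1 2 : K) ≠ 0 := div_ne_zero (u.1 0).ne_zero (u.1 2).ne_zero
    have hb0' : (u'.1 0 : K) / (u'.1 2 : K) ≠ 0 := div_ne_zero (u'.1 0).ne_zero (u'.1 2).ne_zero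
    have hc1 := hc0 u.1 u.2
    have hc2 := hc0 u'.1 u'.2
    have key : (u.1 0 : K) / (u.1 2 : K) * ((u'.1 0 : K) / (u'.1 2 : K)) / (1 + g * (1 - (u.1 1 : K) / (u.1 2 : K) * ((u'.1 1 : K) / (u'.1 2 : K)))) /
        ((u.1 0 : K) / (u.1 2 : K) / (1 + g * (1 - (u.1 1 : K) / (u.1 2 : K))) * ((u'.1 0 : K) / (u'.1 2 : K) / (1 + g * (1 - (u'.1 1 : K) / (u'.1 2 : K))))) =
        (1 + g * (1 - (u.1 1 : K) / (u.1 2 : K))) * (1 + g * (1 - (u'.1 1 : K) / (u'.1 2 : K))) / (1 + g * (1 - (u.1 1 : K) / (u.1 2 : K) * ((u'.1 1 : K) / (u'.1 2 : K)))) := by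
      field_simp
    rw [key]
    refine ⟨by rw [map_div₀, map_mul, hcc, hcc', hC, one_mul, div_one], ?_⟩
    rw [div_sub_one hC0, map_div₀, hC, div_one]
    exact v_defect_le_corner hϖ1.le ρ s e hg ha ha'
  let Θ : S₁ →* Kˣ ⧸ U2 := MonoidHom.mk' (fun u => (QuotientGroup.mk' U2) (θ u)) hmul
  have hΘ : ∀ u : S₁, Θ u = (QuotientGroup.mk' U2) (θ u) := fun u => rfl
  -- kernel `= S̃ ∩ S₁`
  have hker : Θ.ker = S.subgroupOf S₁ := by
    ext u
    obtain ⟨⟨ha1, ha⟩, hu1⟩ := (mem_S₁ u.1).1 u.2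
    rw [MonoidHom.mem_ker, Subgroup.mem_subgroupOf, hΘ, QuotientGroup.mk'_apply, QuotientGroup.eq_one_iff, hU2, hθ, hS,
      mem_latticeStabilizer_latt_glued_corner_lin_iff hϖ0 hϖ1.le ρ s e hx hζ hy'' hg hlin V hV ((mem_unitTorus_iff _).2 hu1)]
    have hb : Valued.v ((u.1 2 : K) - u.1 1) ≤ Valued.v ϖ ^ (ρ + s + e) := by rwa [v_div_sub_one_eq (hu1 2)] at ha
    have h2 : (u.1 2 : K) ≠ 0 := (u.1 2).ne_zero
    have e1 : (u.1 0 : K) / (u.1 2 : K) - (1 + g * (1 - (u.1 1 : K) / (u.1 2 : K))) = -(g * ((u.1 2 : K) - u.1 1) + ((u.1 2 : K) - u.1 0)) / (u.1 2 : K) := by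
      field_simp
      ring
    have hv2 : Valued.v (((u.1 0 : K) / (u.1 2 : K)) / (1 + g * (1 - (u.1 1 : K) / (u.1 2 : K))) - 1) =
        Valued.v (g * ((u.1 2 : K) - u.1 1) + ((u.1 2 : K) - u.1 0)) := by
      rw [div_sub_one (hc0 u.1 u.2), map_div₀, (hcu u.1 u.2).2, div_one, e1, map_div₀, Valuation.map_neg, hu1 2, div_one]
    rw [hv2]
    exact ⟨fun h => ⟨hb, h.2⟩, fun h => ⟨hval u.1 u.2, h.2⟩⟩
  -- image `= 𝒪^× · U_{2ρ+e} ∕ U_{2ρ+e}`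
  have hrange : Θ.range = ((unitTorus K 3).map π).map (QuotientGroup.mk' U2) := by
    ext q
    constructor
    · intro hq
      obtain ⟨u, rfl⟩ := MonoidHom.mem_range.1 hq
      refine Subgroup.mem_map.2 ⟨θ u, ?_, (hΘ u).symm⟩
      rw [mem_map_unitTorus_iff π hπ, hθ]
      exact hval u.1 u.2
    · intro hq
      obtain ⟨w, hw, rfl⟩ := Subgroup.mem_map.1 hq
      rw [mem_map_unitTorus_iff π hπ] at hw
      have h10 : (1 : Fin 3) ≠ 0 := by decide
      have h20 : (2 : Fin 3) ≠ 0 := by decide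
      have hu : Pi.mulSingle (0 : Fin 3) w ∈ S₁ := by
        rw [mem_S₁]
        refine ⟨?_, fun i => ?_⟩
        · rw [Pi.mulSingle_eq_of_ne h10, Pi.mulSingle_eq_of_ne h20, Units.val_one, div_one, sub_self, map_one, map_zero]
          exact ⟨rfl, zero_le⟩
        · by_cases hi : i = 0
          · subst hi; rw [Pi.mulSingle_eq_same]; exact hw
          · rw [Pi.mulSingle_eq_of_ne hi, Units.val_one, map_one]
      refine ⟨⟨_, hu⟩, ?_⟩
      rw [hΘ]
      congr 1
      ext
      rw [hθ]
      simp only [Pi.mulSingle_eq_same, Pi.mulSingle_eq_of_ne h10, Pi.mulSingle_eq_of_ne h20, Units.val_one, div_one, sub_self, mul_zero, add_zero]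
  -- count
  have h1 : S.relIndex S₁ = (S.subgroupOf S₁).index := rfl
  rw [h1, ← hker, Subgroup.index_ker, hrange, ← Subgroup.relIndex_ker, QuotientGroup.ker_mk', ← Subgroup.inf_relIndex_right]
  exact relIndex_unitLevel_eq hϖ (U := (unitTorus K 3).map π) (Un := U2 ⊓ (unitTorus K 3).map π)
    (fun w => mem_map_unitTorus_iff π hπ w) (n := 2 * ρ + e) (by omega)
    (fun w => by rw [Subgroup.mem_inf, hU2, mem_map_unitTorus_iff π hπ, v_pow_eq_exp_neg hϖ]; tauto)

/-! ## §3  Heads: the full-torus index and the orbit size at a general corner; the type-2 letters -/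

/-- **THE GLUED STABILISER INDEX IN THE FULL UNIT TORUS AT A GENERAL CORNER**: `V = (1 0 0; x ϖ^ρ 0; xζ+y″ ϖ^ρζ ϖ^{2ρ+s+e})`, `|x| = |ζ| = 1`, `|y″| = |ϖ|^s`, `ρ ≥ 1`:
`[𝒯 : S̃(latt V)] = ((q−1)·q^{ρ+s+e−1}) · ((q−1)·q^{2ρ+e−1})` (exact lineariser `g = xζ∕y″`). [cite: Kottwitz1986BaseChangeUnits, §1 pp. 240–241] [cite: Serre1979, Ch. IV §2 Prop. 6] -/
theorem relIndex_latticeStabilizer_latt_glued_corner_eq {ϖ : K} (hϖ : Valued.v ϖ = WithZero.exp (-1 : ℤ)) [Finite 𝓀[K]] {ρ : ℕ} (hρ : 1 ≤ ρ) (s e : ℕ) {x ζ y'' : K}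
    (hx : Valued.v x = 1) (hζ : Valued.v ζ = 1) (hy'' : Valued.v y'' = Valued.v ϖ ^ s)
    (V : GL (Fin 3) K) (hV : (V : Matrix (Fin 3) (Fin 3) K) = !![1, 0, 0; x, ϖ ^ ρ, 0; x * ζ + y'', ϖ ^ ρ * ζ, ϖ ^ (2 * ρ + s + e)]) :
    (latticeStabilizer (latt (V : Matrix (Fin 3) (Fin 3) K))).relIndex (unitTorus K 3) =
      ((Nat.card 𝓀[K] - 1) * Nat.card 𝓀[K] ^ (ρ + s + e - 1)) * ((Nat.card 𝓀[K] - 1) * Nat.card 𝓀[K] ^ (2 * ρ + e - 1)) := by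
  obtain ⟨hϖ0, hϖ1⟩ := ne_zero_and_v_lt_one_of_v_eq_exp hϖ
  -- the exact lineariser `g := xζ ∕ y″`
  have hy0 : y'' ≠ 0 := fun h0 => by
    rw [h0, map_zero] at hy''; exact pow_ne_zero _ ((Valuation.ne_zero_iff _).2 hϖ0) hy''.symm
  have hg : Valued.v (x * ζ / y'') * Valued.v ϖ ^ s ≤ 1 := by
    rw [map_div₀, map_mul, hx, hζ, one_mul, hy'', div_mul_cancel₀ _ (pow_ne_zero _ ((Valuation.ne_zero_iff _).2 hϖ0))]
  have hlin : Valued.v (x * ζ - x * ζ / y'' * y'') ≤ Valued.v ϖ ^ ρ := by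
    rw [div_mul_cancel₀ _ hy0, sub_self, map_zero]; exact zero_le
  -- the ratio map and the level group
  let π : (Fin 3 → Kˣ) →* Kˣ := (Pi.evalMonoidHom (fun _ : Fin 3 => Kˣ) 1) / (Pi.evalMonoidHom (fun _ : Fin 3 => Kˣ) 2)
  have hπ : ∀ u, π u = u 1 / u 2 := fun u => rfl
  obtain ⟨Uρs, hU⟩ := exists_unitLevel_subgroup (K := K) (Valued.v ϖ ^ (ρ + s + e))
  -- two steps
  have hle : latticeStabilizer (latt (V : Matrix (Fin 3) (Fin 3) K)) ⊓ unitTorus K 3 ≤ Uρs.comap π ⊓ unitTorus K 3 := by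
    intro u hu
    rw [Subgroup.mem_inf] at hu ⊢
    refine ⟨?_, hu.2⟩
    have hu1 := (mem_unitTorus_iff u).1 hu.2
    obtain ⟨hb, -⟩ := (mem_latticeStabilizer_latt_glued_corner_lin_iff hϖ0 hϖ1.le ρ s e hx hζ hy'' hg hlin V hV hu.2).1 hu.1
    rw [Subgroup.mem_comap, hU, hπ, Units.val_div_eq_div_val]
    refine ⟨by rw [map_div₀, hu1 1, hu1 2, div_one], ?_⟩
    rw [v_div_sub_one_eq (hu1 2)]; exact hb
  have hS₁T : Uρs.comap π ⊓ unitTorus K 3 ≤ unitTorus K 3 := inf_le_right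
  have hinf : latticeStabilizer (latt (V : Matrix (Fin 3) (Fin 3) K)) ⊓ (Uρs.comap π ⊓ unitTorus K 3) =
      latticeStabilizer (latt (V : Matrix (Fin 3) (Fin 3) K)) ⊓ unitTorus K 3 :=
    le_antisymm (inf_le_inf_left _ hS₁T) (le_inf inf_le_left hle)
  rw [← Subgroup.inf_relIndex_right (latticeStabilizer _) (unitTorus K 3), ← hinf, ← Subgroup.relIndex_inf_mul_relIndex, inf_of_le_left hS₁T,
    relIndex_latticeStabilizer_ratioLevel_corner_eq hϖ hρ s e hx hζ hy'' hg hlin V hV π hπ Uρs hU,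
    relIndex_ratioLevel_unitTorus_eq hϖ (n := ρ + s + e) (by omega) π hπ Uρs hU, Nat.mul_comm]

/-- **THE ORBIT OF A GLUED LATTICE UNDER THE UNIT TORUS, general corner, has `((q−1)·q^{ρ+s+e−1})·((q−1)·q^{2ρ+e−1})` members** (★ (O1) + the index).
[cite: Kottwitz1986BaseChangeUnits, §1 pp. 240–241] -/
theorem ncard_unitTorus_orbit_latt_glued_corner_eq {ϖ : K} (hϖ : Valued.v ϖ = WithZero.exp (-1 : ℤ)) [Finite 𝓀[K]] {ρ : ℕ} (hρ : 1 ≤ ρ) (s e : ℕ) {x ζ y'' : K}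
    (hx : Valued.v x = 1) (hζ : Valued.v ζ = 1) (hy'' : Valued.v y'' = Valued.v ϖ ^ s)
    (V : GL (Fin 3) K) (hV : (V : Matrix (Fin 3) (Fin 3) K) = !![1, 0, 0; x, ϖ ^ ρ, 0; x * ζ + y'', ϖ ^ ρ * ζ, ϖ ^ (2 * ρ + s + e)]) :
    {M : Submodule 𝒪[K] (Fin 3 → K) | ∃ u ∈ unitTorus K 3, M = mapGL (diagGLUnits u) (latt (V : Matrix (Fin 3) (Fin 3) K))}.ncard =
      ((Nat.card 𝓀[K] - 1) * Nat.card 𝓀[K] ^ (ρ + s + e - 1)) * ((Nat.card 𝓀[K] - 1) * Nat.card 𝓀[K] ^ (2 * ρ + e - 1)) := by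
  rw [ncard_unitTorus_orbit_eq_relIndex, relIndex_latticeStabilizer_latt_glued_corner_eq hϖ hρ s e hx hζ hy'' V hV]

/-- **TYPE 2** (MEMO v2.1 §T2.3, `G₁(2ρ+1, s)`, corner `2ρ+1+s`): `[𝒯 : S̃(latt V)] = ((q−1)·q^{ρ+s})·((q−1)·q^{2ρ})`. [cite: Kottwitz1986BaseChangeUnits, §1 pp. 240–241] -/
theorem relIndex_latticeStabilizer_latt_glued_typeTwo_eq {ϖ : K} (hϖ : Valued.v ϖ = WithZero.exp (-1 : ℤ)) [Finite 𝓀[K]] {ρ : ℕ} (hρ : 1 ≤ ρ) (s : ℕ) {x ζ y'' : K}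
    (hx : Valued.v x = 1) (hζ : Valued.v ζ = 1) (hy'' : Valued.v y'' = Valued.v ϖ ^ s)
    (V : GL (Fin 3) K) (hV : (V : Matrix (Fin 3) (Fin 3) K) = !![1, 0, 0; x, ϖ ^ ρ, 0; x * ζ + y'', ϖ ^ ρ * ζ, ϖ ^ (2 * ρ + 1 + s)]) :
    (latticeStabilizer (latt (V : Matrix (Fin 3) (Fin 3) K))).relIndex (unitTorus K 3) =
      ((Nat.card 𝓀[K] - 1) * Nat.card 𝓀[K] ^ (ρ + s)) * ((Nat.card 𝓀[K] - 1) * Nat.card 𝓀[K] ^ (2 * ρ)) := by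
  have hV1 : (V : Matrix (Fin 3) (Fin 3) K) = !![1, 0, 0; x, ϖ ^ ρ, 0; x * ζ + y'', ϖ ^ ρ * ζ, ϖ ^ (2 * ρ + s + 1)] := by
    rw [hV, show 2 * ρ + 1 + s = 2 * ρ + s + 1 by ring]
  rw [relIndex_latticeStabilizer_latt_glued_corner_eq hϖ hρ s 1 hx hζ hy'' V hV1, Nat.add_sub_cancel, Nat.add_sub_cancel]

/-- **TYPE 2, ORBIT SIZE**: `#(𝒯·latt V) = ((q−1)·q^{ρ+s})·((q−1)·q^{2ρ})` on `G₁(2ρ+1, s)`. [cite: Kottwitz1986BaseChangeUnits, §1 pp. 240–241] -/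
theorem ncard_unitTorus_orbit_latt_glued_typeTwo_eq {ϖ : K} (hϖ : Valued.v ϖ = WithZero.exp (-1 : ℤ)) [Finite 𝓀[K]] {ρ : ℕ} (hρ : 1 ≤ ρ) (s : ℕ) {x ζ y'' : K}
    (hx : Valued.v x = 1) (hζ : Valued.v ζ = 1) (hy'' : Valued.v y'' = Valued.v ϖ ^ s)
    (V : GL (Fin 3) K) (hV : (V : Matrix (Fin 3) (Fin 3) K) = !![1, 0, 0; x, ϖ ^ ρ, 0; x * ζ + y'', ϖ ^ ρ * ζ, ϖ ^ (2 * ρ + 1 + s)]) :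
    {M : Submodule 𝒪[K] (Fin 3 → K) | ∃ u ∈ unitTorus K 3, M = mapGL (diagGLUnits u) (latt (V : Matrix (Fin 3) (Fin 3) K))}.ncard =
      ((Nat.card 𝓀[K] - 1) * Nat.card 𝓀[K] ^ (ρ + s)) * ((Nat.card 𝓀[K] - 1) * Nat.card 𝓀[K] ^ (2 * ρ)) := by
  rw [ncard_unitTorus_orbit_eq_relIndex, relIndex_latticeStabilizer_latt_glued_typeTwo_eq hϖ hρ s hx hζ hy'' V hV]

end Summit.HodgeConjecture.HodgeConjecture.Cruxes.H413.F0P3cDyRamDiagonalGluedStabiliserIndexFullCorner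

end
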